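/-
Copyright (c) 2026 the pub-hodgecm-mathlib formalisation cell (harness21).  Prover seat hodgecm-mathlib-F0P2-p01 (g11), programme P2,
row B⁗ (sequel) «Θ-OCC-GEN AT THE FRAME FROM ARCHIMEDEAN THETA-PAIR CONDITIONS + ONE NON-VANISHING» for the desk's OCC♭-GEN line (stub Θ-OCC-GEN
`StubThetaOccursInGen`), 2026-09-01.  KERNEL module: THEOREMS ONLY (no definition, no named fact, no `sorry`, no instance, no notation).
-/
import Summits.HodgeConjecture.HodgeConjecture.Theorems.F0P2sThetaPairsCotForms   -- ★ B⁗: theta pairs — left invariance and smoothness are free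
import HarnessLib

/-!
# FLOOR-0 P2 · B⁗ (sequel): the `∃ θ`-clause of Θ-OCC-GEN — values in `cohForms (cmArchSection, cmCompactFactor)` — from the ARCHIMEDEAN conditions
# (W)(K)(H) on the theta pairs (for every `Φ_f`) and ONE non-vanishing theta pair

Cell hodgecm-mathlib (D-0151), FLOOR 0; crux item H413 = stmt-HodgeConjecture-24833 (route `HCCMUnconditional`, no route verbs); programme P2, the
OCC♭-GEN pay-down line of OCC♭∀ (books #155′; desk F0P2-plan (g12) ED. 1, ONE letter Θ-OCC-GEN `StubThetaOccursInGen` in function currency).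
Sequel of ★ `Theorems/F0P2sThetaFunIntertwiner` (θ_φ), ★ `Theorems/F0P2sThetaOccursInOfPairs` (the `∃ θ`-clause from (T∀)+(N)) and ★
`Theorems/F0P2sThetaPairsCotForms` (left invariance + finite-adelic smoothness of theta pairs are free; `holCotForms` ∕ its conjugate from (W)(K)(H)).
THEOREMS ONLY; `--supports stmt-HodgeConjecture-24833`.  HONEST LABEL: HC_CM is proved only modulo the printed citations until rung 0 closes; this file
closes NO print letter and asserts nothing of [Liu2021]: it is the sorry-free assembly that leaves, of Θ-OCC-GEN, exactly the ARCHIMEDEAN oscillator content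
([KonnoKonno2007, Thm 5.4] ∕ [Liu2021, Lem. D.2]: a `K_∞`-cotangent, `K_c`-fixed, `𝔭⁻`-annihilated pair of archimedean Schwartz vectors) and the GLOBAL
non-vanishing of one theta lift ([GelbartRogawski1991, Prop. 3.1.1]; [Liu2021, Prop. 4.13 «Conversely»]).

## What is proved (OCC♭∀ frame `L ι H T hT e₁ dV hdV hdV0 g hg ιV hιV μ hμ a χ`; theta data `hρ [CompactSpace [U(diag dV)]] μW`, `φ : Fin 2 → 𝓢`)
* **`exists_ne_zero_forall_mem_cohForms_thetaFunIntertwiner_of_hol_arch`** — if for EVERY `Φ_f` the theta pair `fun x j ↦ Θ̃_{R_e E(φ_j ⊗ Φ_f)}(charCM χ̃_χ)(ιA x)`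
  satisfies (W) `K_∞`-type `weightOf x₀` along `cmArchSection`, (K) `cmCompactFactor`-invariance, (H) holomorphic germs along `cmArchSection`, and ONE theta pair
  is non-zero, then `∃ θ : omegaAtLine … a χ →ₗ[ℂ] (U(H)(𝔸_{L⁺}) → ℂ²), θ ≠ 0 ∧ (∀ w, θ w ∈ cohForms … (cmArchSection …) (cmCompactFactor …)) ∧
  ∀ k w, θ (rhoAtLine … ιV a χ k w) = fun x ↦ θ w (x * finAdelicToAdelic k)` — the `∃ θ`-clause of `StubThetaOccursInGen` TOKEN FOR TOKEN;
* **`exists_ne_zero_forall_mem_cohForms_thetaFunIntertwiner_of_antihol_arch`** — the same from (W̄)(K)(H̄) on the CONJUGATE pairs (antiholomorphic type).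

## References
* [Liu2021] Y. Liu, *Fourier–Jacobi cycles and arithmetic relative trace formula*, Camb. J. Math. 9 (2021) = arXiv:2102.11518, Prop. 4.13 («Conversely»
  l. 2145–2149); Def. 4.11; App. D §D.1 Step 3, Lem. D.2.
* [GelbartRogawski1991] S. Gelbart, J. Rogawski, Invent. Math. 105 (1991), §3.1 Prop. 3.1.1, §3.2 p. 457.
* [KonnoKonno2007] T. Konno, K. Konno, Kyushu J. Math. 61 (2007), Thm 5.4.  [BorelWallach2000] VII 2.10, 3.2.  [BorelJacquet1979] §4.1, §4.2.
-/

set_option autoImplicit false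

-- the mandated namespace has the single-problem summit's repeated segment (`HodgeConjecture.HodgeConjecture`)
set_option linter.dupNamespace false

noncomputable section

open NumberField MeasureTheory IsDedekindDomain MulAction
open scoped Matrix Kronecker ComplexOrder ENNReal SchwartzMap TensorProduct Classical

namespace Summit.HodgeConjecture.HodgeConjecture.Cruxes.H413.F0P2sThetaOccursInOfArch

open Literature.NumberTheory.Automorphic Literature.NumberTheory.Automorphic.UnitaryGroup
open Literature.NumberTheory.Automorphic.UnitaryGroup.CotangentForms
open Literature.NumberTheory.Automorphic.IdeleClassGroup
open Literature.NumberTheory.Automorphic.Liu2021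
open Literature.NumberTheory.Automorphic.Liu2021.Def411WeilCarriers
open Literature.NumberTheory.Automorphic.Liu2021.Def411WeilCarriersDoubling
open Literature.NumberTheory.GelbartRogawski1991 Literature.NumberTheory.GelbartRogawski1991.UnitaryDualPair
open Literature.NumberTheory.GelbartRogawski1991.UnitaryDualPair.WeilCoinv
open Literature.NumberTheory.Weil1964
open Literature.RepresentationTheory Literature.RepresentationTheory.Liu2021
open Literature.RepresentationTheory.CompactGroups
open Literature.AlgebraicGeometry.ShimuraVarieties (BallForms.isPullbackCocycle_cotangentCocycle)
open Literature.Geometry.ComplexHyperbolic.BallModel (U21 x₀)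
open Summit.HodgeConjecture.HodgeConjecture.Cruxes.H413
open Summit.HodgeConjecture.HodgeConjecture.Cruxes.H413.F0P2sThetaOccursInOfPairs
open Summit.HodgeConjecture.HodgeConjecture.Cruxes.H413.F0P2sThetaPairsCotForms

variable (L : Type) [Field L] [NumberField L] [IsCMField L] (ι : L →+* ℂ) (H : Matrix (Fin 3) (Fin 3) L) (T : GL (Fin 3) ℂ)
  (hT : (T : Matrix (Fin 3) (Fin 3) ℂ)ᴴ * H.map ι * (T : Matrix (Fin 3) (Fin 3) ℂ) = Literature.Geometry.ComplexHyperbolic.BallModel.J)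
  {n' : ℕ} (e₁ : Fin 3 × Fin 1 ≃ Fin n') (dV : Fin 3 → L) (hdV : ∀ i, IsCMField.complexConj L (dV i) = dV i)
  (hdV0 : ∀ i, dV i ≠ 0) (g : GL (Fin 3) L)
  (hg : ((g : Matrix (Fin 3) (Fin 3) L).map (cmConjRingHom L))ᵀ * H * (g : Matrix (Fin 3) (Fin 3) L) = Matrix.diagonal dV)
  (ιV : finAdelic (↥(maximalRealSubfield L)) L (IsCMField.complexConj L) 3 H →*
    finAdelic (↥(maximalRealSubfield L)) L (IsCMField.complexConj L) 3 (Matrix.diagonal dV))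
  (hιV : ∀ k, ((ιV k : finAdelic (↥(maximalRealSubfield L)) L (IsCMField.complexConj L) 3 (Matrix.diagonal dV)) :
        GL (Fin 3) (FiniteAdeleRing (𝓞 L) L)) =
      (toFinAdeleGL L 3 g)⁻¹ * (k : GL (Fin 3) (FiniteAdeleRing (𝓞 L) L)) * toFinAdeleGL L 3 g)
  (μ : Literature.NumberTheory.Automorphic.IdeleClassGroup L →ₜ* Circle) (hμ : IsConjugateSymplectic L μ) (a : (↥(maximalRealSubfield L))ˣ)
  (χ : Chi (↥(maximalRealSubfield L)) L (IsCMField.complexConj L))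
  (hρ : HasThetaMajorants fun
      (p : ↥(UnitaryGroup.adelic (↥(maximalRealSubfield L)) L (IsCMField.complexConj L) 3 (Matrix.diagonal dV)) × ↥(UnitaryGroup.adelic (↥(maximalRealSubfield L)) L (IsCMField.complexConj L) 1 (JW (↥(maximalRealSubfield L)) L a))) (Φ : piSchwartzBruhat (↥(maximalRealSubfield L)) (Fin n')) =>
        pairRep (↥(maximalRealSubfield L)) L (IsCMField.complexConj L) 3 1 e₁ (Matrix.diagonal dV) (JW (↥(maximalRealSubfield L)) L a)
          (chiSplittingLine L e₁ dV hdV hdV0 (toHeckeCharacter L μ) (isUnitary_toHeckeCharacter L μ)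
            ((isOscillatorChar_toHeckeCharacter_iff μ).mpr hμ) (TW (↥(maximalRealSubfield L)) a)
            (isUnit_det_TW (↥(maximalRealSubfield L)) a) (JW (↥(maximalRealSubfield L)) L a) (JW_eq (↥(maximalRealSubfield L)) L a))
          p Φ)
  [CompactSpace (↥(UnitaryGroup.adelic (↥(maximalRealSubfield L)) L (IsCMField.complexConj L) 3 (Matrix.diagonal dV)) ⧸ (UnitaryGroup.toAdelic (↥(maximalRealSubfield L)) L (IsCMField.complexConj L) 3 (Matrix.diagonal dV)).range)]
  [MeasurableSpace (↥(UnitaryGroup.adelic (↥(maximalRealSubfield L)) L (IsCMField.complexConj L) 1 (JW (↥(maximalRealSubfield L)) L a)) ⧸ (UnitaryGroup.toAdelic (↥(maximalRealSubfield L)) L (IsCMField.complexConj L) 1 (JW (↥(maximalRealSubfield L)) L a)).range)] [BorelSpace (↥(UnitaryGroup.adelic (↥(maximalRealSubfield L)) L (IsCMField.complexConj L) 1 (JW (↥(maximalRealSubfield L)) L a)) ⧸ (UnitaryGroup.toAdelic (↥(maximalRealSubfield L)) L (IsCMField.complexConj L) 1 (JW (↥(maximalRealSubfield L)) L a)).range)]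 (μW : Measure (↥(UnitaryGroup.adelic (↥(maximalRealSubfield L)) L (IsCMField.complexConj L) 1 (JW (↥(maximalRealSubfield L)) L a)) ⧸ (UnitaryGroup.toAdelic (↥(maximalRealSubfield L)) L (IsCMField.complexConj L) 1 (JW (↥(maximalRealSubfield L)) L a)).range)) [IsFiniteMeasure μW] [SMulInvariantMeasure ↥(UnitaryGroup.adelic (↥(maximalRealSubfield L)) L (IsCMField.complexConj L) 1 (JW (↥(maximalRealSubfield L)) L a)) (↥(UnitaryGroup.adelic (↥(maximalRealSubfield L)) L (IsCMField.complexConj L) 1 (JW (↥(maximalRealSubfield L)) L a)) ⧸ (UnitaryGroup.toAdelic (↥(maximalRealSubfield L)) L (IsCMField.complexConj L) 1 (JW (↥(maximalRealSubfield L)) L a)).range) μW]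
  (φ : Fin 2 → 𝓢(((Fin 3 × Fin 1) → NumberField.mixedEmbedding.mixedSpace ↥(maximalRealSubfield L)), ℂ))

include hT hg hιV in
set_option synthInstance.maxHeartbeats 400000 in
set_option maxHeartbeats 4000000 in
/-- **Θ-OCC-GEN's `∃ θ`-clause (HOLOMORPHIC TYPE) FROM ARCHIMEDEAN CONDITIONS + ONE NON-VANISHING.**  If for every finite Schwartz–Bruhat `Φ_f` the theta pair
of `(φ₀, φ₁; a, χ)` has (W) `K_∞`-type `weightOf x₀` along `cmArchSection`, (K) `cmCompactFactor`-invariance and (H) holomorphic germs along `cmArchSection`,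
and some theta pair is non-zero, then the theta intertwiner `θ_φ` is a NON-ZERO `ρ(a,χ)`-equivariant map with values in `cohForms (cmArchSection, cmCompactFactor)`
(indeed in `holCotForms`): the conclusion of `StubThetaOccursInGen` at the frame.
[cite: Liu2021, Prop. 4.13 («Conversely» l. 2145–2149); App. D §D.1 Step 3, Lem. D.2] [cite: GelbartRogawski1991, Prop. 3.1.1; §3.2 p. 457]
[cite: KonnoKonno2007, Thm 5.4] [cite: BorelWallach2000, VII 2.10] -/
theorem exists_ne_zero_forall_mem_cohForms_thetaFunIntertwiner_of_hol_arch
    (hW : haveI := normal_range_toAdelic_JW L a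
      ∀ (Φf : FinSB (↥(maximalRealSubfield L)) (Fin 3 × Fin 1)) (k : ↥(stabilizer (↥U21) x₀))
        (x : (adelicGroupData (↥(maximalRealSubfield L)) L (IsCMField.complexConj L) 3 H).Adelic),
        (fun (j : Fin 2) =>
            (lineThetaKernelDatum L 3 e₁ dV hdV hdV0 μ hμ a hρ).thetaLiftFun μW
              (piSBReindex (↥(maximalRealSubfield L)) e₁ (piSchwartzBruhatEquiv (↥(maximalRealSubfield L)) (Fin 3 × Fin 1) (φ j ⊗ₜ[ℂ] Φf)))
              (charCM (chiQuot (↥(maximalRealSubfield L)) L (IsCMField.complexConj L) (Algebra.IsQuadraticExtension.finrank_eq_two _ L)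
                (IsCMField.complexConj_ne_one (K := L)) a χ))
              ((cmAdelicFrameTransport L 3 H dV g hg) (x * ((cmArchSection L ι H T hT).comp (stabilizer (↥U21) x₀).subtype) k))) =
          (BallForms.isPullbackCocycle_cotangentCocycle.weightOf x₀) k⁻¹ (fun (j : Fin 2) =>
            (lineThetaKernelDatum L 3 e₁ dV hdV hdV0 μ hμ a hρ).thetaLiftFun μW
              (piSBReindex (↥(maximalRealSubfield L)) e₁ (piSchwartzBruhatEquiv (↥(maximalRealSubfield L)) (Fin 3 × Fin 1) (φ j ⊗ₜ[ℂ] Φf)))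
              (charCM (chiQuot (↥(maximalRealSubfield L)) L (IsCMField.complexConj L) (Algebra.IsQuadraticExtension.finrank_eq_two _ L)
                (IsCMField.complexConj_ne_one (K := L)) a χ))
              ((cmAdelicFrameTransport L 3 H dV g hg) x)))
    (hK : haveI := normal_range_toAdelic_JW L a
      ∀ (Φf : FinSB (↥(maximalRealSubfield L)) (Fin 3 × Fin 1)), ∀ k ∈ cmCompactFactor L ι H T hT,
        ∀ (x : (adelicGroupData (↥(maximalRealSubfield L)) L (IsCMField.complexConj L) 3 H).Adelic),
        (fun (j : Fin 2) =>
            (lineThetaKernelDatum L 3 e₁ dV hdV hdV0 μ hμ a hρ).thetaLiftFun μW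
              (piSBReindex (↥(maximalRealSubfield L)) e₁ (piSchwartzBruhatEquiv (↥(maximalRealSubfield L)) (Fin 3 × Fin 1) (φ j ⊗ₜ[ℂ] Φf)))
              (charCM (chiQuot (↥(maximalRealSubfield L)) L (IsCMField.complexConj L) (Algebra.IsQuadraticExtension.finrank_eq_two _ L)
                (IsCMField.complexConj_ne_one (K := L)) a χ))
              ((cmAdelicFrameTransport L 3 H dV g hg) (x * k))) =
          fun (j : Fin 2) =>
            (lineThetaKernelDatum L 3 e₁ dV hdV hdV0 μ hμ a hρ).thetaLiftFun μW
              (piSBReindex (↥(maximalRealSubfield L)) e₁ (piSchwartzBruhatEquiv (↥(maximalRealSubfield L)) (Fin 3 × Fin 1) (φ j ⊗ₜ[ℂ] Φf)))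
              (charCM (chiQuot (↥(maximalRealSubfield L)) L (IsCMField.complexConj L) (Algebra.IsQuadraticExtension.finrank_eq_two _ L)
                (IsCMField.complexConj_ne_one (K := L)) a χ))
              ((cmAdelicFrameTransport L 3 H dV g hg) x))
    (hH : haveI := normal_range_toAdelic_JW L a
      ∀ (Φf : FinSB (↥(maximalRealSubfield L)) (Fin 3 × Fin 1)),
        IsHolGerm (cmArchSection L ι H T hT) (fun (x : (adelicGroupData (↥(maximalRealSubfield L)) L (IsCMField.complexConj L) 3 H).Adelic) (j : Fin 2) =>
          (lineThetaKernelDatum L 3 e₁ dV hdV hdV0 μ hμ a hρ).thetaLiftFun μW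
            (piSBReindex (↥(maximalRealSubfield L)) e₁ (piSchwartzBruhatEquiv (↥(maximalRealSubfield L)) (Fin 3 × Fin 1) (φ j ⊗ₜ[ℂ] Φf)))
            (charCM (chiQuot (↥(maximalRealSubfield L)) L (IsCMField.complexConj L) (Algebra.IsQuadraticExtension.finrank_eq_two _ L)
              (IsCMField.complexConj_ne_one (K := L)) a χ))
            ((cmAdelicFrameTransport L 3 H dV g hg) x)))
    (hN : haveI := normal_range_toAdelic_JW L a
      ∃ Φf : FinSB (↥(maximalRealSubfield L)) (Fin 3 × Fin 1),
        (fun (x : (adelicGroupData (↥(maximalRealSubfield L)) L (IsCMField.complexConj L) 3 H).Adelic) (j : Fin 2) =>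
            (lineThetaKernelDatum L 3 e₁ dV hdV hdV0 μ hμ a hρ).thetaLiftFun μW
              (piSBReindex (↥(maximalRealSubfield L)) e₁ (piSchwartzBruhatEquiv (↥(maximalRealSubfield L)) (Fin 3 × Fin 1) (φ j ⊗ₜ[ℂ] Φf)))
              (charCM (chiQuot (↥(maximalRealSubfield L)) L (IsCMField.complexConj L) (Algebra.IsQuadraticExtension.finrank_eq_two _ L)
                (IsCMField.complexConj_ne_one (K := L)) a χ))
              ((cmAdelicFrameTransport L 3 H dV g hg) x)) ≠ 0) :
    ∃ θ : omegaAtLine (↥(maximalRealSubfield L)) L (IsCMField.complexConj L) 3 e₁ (Matrix.diagonal dV)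
          (complexConj_imagUnit L) (imagUnit_ne_zero L) (imagUnit_mul_self L) (realDiagonal_isSymm L dV hdV)
          (isUnit_det_realDiagonal L dV hdV hdV0) (realDiagonal_map L dV hdV).symm
          (fun b => isCompatible_chiSplittingLine L e₁ dV hdV hdV0 (toHeckeCharacter L μ)
            (isUnitary_toHeckeCharacter L μ) ((isOscillatorChar_toHeckeCharacter_iff μ).mpr hμ)
            (TW (↥(maximalRealSubfield L)) b) (isSymm_TW (↥(maximalRealSubfield L)) b)
            (isUnit_det_TW (↥(maximalRealSubfield L)) b) (JW (↥(maximalRealSubfield L)) L b)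
            (JW_eq (↥(maximalRealSubfield L)) L b)) a χ →ₗ[ℂ]
        ((adelicGroupData (↥(maximalRealSubfield L)) L (IsCMField.complexConj L) 3 H).Adelic → (Fin 2 → ℂ)),
      θ ≠ 0 ∧
        (∀ w, θ w ∈ CotangentForms.cohForms (↥(maximalRealSubfield L)) L (IsCMField.complexConj L) 3 H
            (cmArchSection L ι H T hT) (cmCompactFactor L ι H T hT)) ∧
        ∀ (k : ↥(finAdelic (↥(maximalRealSubfield L)) L (IsCMField.complexConj L) 3 H)) w,
          θ (rhoAtLine (↥(maximalRealSubfield L)) L (IsCMField.complexConj L) 3 e₁ (Matrix.diagonal dV)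
              (complexConj_imagUnit L) (imagUnit_ne_zero L) (imagUnit_mul_self L) (realDiagonal_isSymm L dV hdV)
              (isUnit_det_realDiagonal L dV hdV hdV0) (realDiagonal_map L dV hdV).symm
              (fun a => isCompatible_chiSplittingLine L e₁ dV hdV hdV0 (toHeckeCharacter L μ)
                (isUnitary_toHeckeCharacter L μ) ((isOscillatorChar_toHeckeCharacter_iff μ).mpr hμ)
                (TW (↥(maximalRealSubfield L)) a) (isSymm_TW (↥(maximalRealSubfield L)) a)
                (isUnit_det_TW (↥(maximalRealSubfield L)) a) (JW (↥(maximalRealSubfield L)) L a)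
                (JW_eq (↥(maximalRealSubfield L)) L a)) ιV a χ k w) =
            fun x => θ w (x * finAdelicToAdelic (↥(maximalRealSubfield L)) L (IsCMField.complexConj L) 3 H k) :=
  exists_ne_zero_forall_mem_thetaFunIntertwiner_of_coe L 3 H e₁ dV hdV hdV0 g hg μ hμ a hρ μW _ φ χ ιV hιV
    (fun Φf => holCotForms_le_cohForms
      (thetaPair_mem_holCotForms_of_arch L ι H T hT e₁ dV hdV hdV0 g hg ιV hιV μ hμ a χ hρ μW φ Φf (hW Φf) (hK Φf) (hH Φf)))
    hN

include hT hg hιV in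
set_option synthInstance.maxHeartbeats 400000 in
set_option maxHeartbeats 4000000 in
/-- **Θ-OCC-GEN's `∃ θ`-clause (ANTIHOLOMORPHIC TYPE) FROM ARCHIMEDEAN CONDITIONS ON THE CONJUGATE PAIRS + ONE NON-VANISHING**: (W̄)(K)(H̄) for the
conjugate theta pairs `conjFun (theta pair)` for every `Φ_f`, one theta pair non-zero ⟹ `θ_φ ≠ 0`, `ρ(a,χ)`-equivariant, with values in
`cohForms (cmArchSection, cmCompactFactor)` (indeed in the conjugate of `holCotForms`).
[cite: Liu2021, Prop. 4.13 («Conversely» l. 2145–2149); App. D §D.1 Step 3, Lem. D.2] [cite: GelbartRogawski1991, Prop. 3.1.1; §3.2 p. 457]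
[cite: KonnoKonno2007, Thm 5.4] [cite: BorelWallach2000, VII 2.10] -/
theorem exists_ne_zero_forall_mem_cohForms_thetaFunIntertwiner_of_antihol_arch
    (hW : haveI := normal_range_toAdelic_JW L a
      ∀ (Φf : FinSB (↥(maximalRealSubfield L)) (Fin 3 × Fin 1)) (k : ↥(stabilizer (↥U21) x₀))
        (x : (adelicGroupData (↥(maximalRealSubfield L)) L (IsCMField.complexConj L) 3 H).Adelic),
        conjFun (↥(maximalRealSubfield L)) L (IsCMField.complexConj L) 3 H (fun (x : (adelicGroupData (↥(maximalRealSubfield L)) L (IsCMField.complexConj L) 3 H).Adelic) (j : Fin 2) =>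
            (lineThetaKernelDatum L 3 e₁ dV hdV hdV0 μ hμ a hρ).thetaLiftFun μW
              (piSBReindex (↥(maximalRealSubfield L)) e₁ (piSchwartzBruhatEquiv (↥(maximalRealSubfield L)) (Fin 3 × Fin 1) (φ j ⊗ₜ[ℂ] Φf)))
              (charCM (chiQuot (↥(maximalRealSubfield L)) L (IsCMField.complexConj L) (Algebra.IsQuadraticExtension.finrank_eq_two _ L)
                (IsCMField.complexConj_ne_one (K := L)) a χ))
              ((cmAdelicFrameTransport L 3 H dV g hg) x)) (x * ((cmArchSection L ι H T hT).comp (stabilizer (↥U21) x₀).subtype) k) =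
          (BallForms.isPullbackCocycle_cotangentCocycle.weightOf x₀) k⁻¹
            (conjFun (↥(maximalRealSubfield L)) L (IsCMField.complexConj L) 3 H (fun (x : (adelicGroupData (↥(maximalRealSubfield L)) L (IsCMField.complexConj L) 3 H).Adelic) (j : Fin 2) =>
              (lineThetaKernelDatum L 3 e₁ dV hdV hdV0 μ hμ a hρ).thetaLiftFun μW
                (piSBReindex (↥(maximalRealSubfield L)) e₁ (piSchwartzBruhatEquiv (↥(maximalRealSubfield L)) (Fin 3 × Fin 1) (φ j ⊗ₜ[ℂ] Φf)))
                (charCM (chiQuot (↥(maximalRealSubfield L)) L (IsCMField.complexConj L) (Algebra.IsQuadraticExtension.finrank_eq_two _ L)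
                  (IsCMField.complexConj_ne_one (K := L)) a χ))
                ((cmAdelicFrameTransport L 3 H dV g hg) x)) x))
    (hK : haveI := normal_range_toAdelic_JW L a
      ∀ (Φf : FinSB (↥(maximalRealSubfield L)) (Fin 3 × Fin 1)), ∀ k ∈ cmCompactFactor L ι H T hT,
        ∀ (x : (adelicGroupData (↥(maximalRealSubfield L)) L (IsCMField.complexConj L) 3 H).Adelic),
        (fun (j : Fin 2) =>
            (lineThetaKernelDatum L 3 e₁ dV hdV hdV0 μ hμ a hρ).thetaLiftFun μW
              (piSBReindex (↥(maximalRealSubfield L)) e₁ (piSchwartzBruhatEquiv (↥(maximalRealSubfield L)) (Fin 3 × Fin 1) (φ j ⊗ₜ[ℂ] Φf)))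
              (charCM (chiQuot (↥(maximalRealSubfield L)) L (IsCMField.complexConj L) (Algebra.IsQuadraticExtension.finrank_eq_two _ L)
                (IsCMField.complexConj_ne_one (K := L)) a χ))
              ((cmAdelicFrameTransport L 3 H dV g hg) (x * k))) =
          fun (j : Fin 2) =>
            (lineThetaKernelDatum L 3 e₁ dV hdV hdV0 μ hμ a hρ).thetaLiftFun μW
              (piSBReindex (↥(maximalRealSubfield L)) e₁ (piSchwartzBruhatEquiv (↥(maximalRealSubfield L)) (Fin 3 × Fin 1) (φ j ⊗ₜ[ℂ] Φf)))
              (charCM (chiQuot (↥(maximalRealSubfield L)) L (IsCMField.complexConj L) (Algebra.IsQuadraticExtension.finrank_eq_two _ L)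
                (IsCMField.complexConj_ne_one (K := L)) a χ))
              ((cmAdelicFrameTransport L 3 H dV g hg) x))
    (hH : haveI := normal_range_toAdelic_JW L a
      ∀ (Φf : FinSB (↥(maximalRealSubfield L)) (Fin 3 × Fin 1)),
        IsHolGerm (cmArchSection L ι H T hT) (conjFun (↥(maximalRealSubfield L)) L (IsCMField.complexConj L) 3 H
          (fun (x : (adelicGroupData (↥(maximalRealSubfield L)) L (IsCMField.complexConj L) 3 H).Adelic) (j : Fin 2) =>
            (lineThetaKernelDatum L 3 e₁ dV hdV hdV0 μ hμ a hρ).thetaLiftFun μW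
              (piSBReindex (↥(maximalRealSubfield L)) e₁ (piSchwartzBruhatEquiv (↥(maximalRealSubfield L)) (Fin 3 × Fin 1) (φ j ⊗ₜ[ℂ] Φf)))
              (charCM (chiQuot (↥(maximalRealSubfield L)) L (IsCMField.complexConj L) (Algebra.IsQuadraticExtension.finrank_eq_two _ L)
                (IsCMField.complexConj_ne_one (K := L)) a χ))
              ((cmAdelicFrameTransport L 3 H dV g hg) x))))
    (hN : haveI := normal_range_toAdelic_JW L a
      ∃ Φf : FinSB (↥(maximalRealSubfield L)) (Fin 3 × Fin 1),
        (fun (x : (adelicGroupData (↥(maximalRealSubfield L)) L (IsCMField.complexConj L) 3 H).Adelic) (j : Fin 2) =>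
            (lineThetaKernelDatum L 3 e₁ dV hdV hdV0 μ hμ a hρ).thetaLiftFun μW
              (piSBReindex (↥(maximalRealSubfield L)) e₁ (piSchwartzBruhatEquiv (↥(maximalRealSubfield L)) (Fin 3 × Fin 1) (φ j ⊗ₜ[ℂ] Φf)))
              (charCM (chiQuot (↥(maximalRealSubfield L)) L (IsCMField.complexConj L) (Algebra.IsQuadraticExtension.finrank_eq_two _ L)
                (IsCMField.complexConj_ne_one (K := L)) a χ))
              ((cmAdelicFrameTransport L 3 H dV g hg) x)) ≠ 0) :
    ∃ θ : omegaAtLine (↥(maximalRealSubfield L)) L (IsCMField.complexConj L) 3 e₁ (Matrix.diagonal dV)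
          (complexConj_imagUnit L) (imagUnit_ne_zero L) (imagUnit_mul_self L) (realDiagonal_isSymm L dV hdV)
          (isUnit_det_realDiagonal L dV hdV hdV0) (realDiagonal_map L dV hdV).symm
          (fun b => isCompatible_chiSplittingLine L e₁ dV hdV hdV0 (toHeckeCharacter L μ)
            (isUnitary_toHeckeCharacter L μ) ((isOscillatorChar_toHeckeCharacter_iff μ).mpr hμ)
            (TW (↥(maximalRealSubfield L)) b) (isSymm_TW (↥(maximalRealSubfield L)) b)
            (isUnit_det_TW (↥(maximalRealSubfield L)) b) (JW (↥(maximalRealSubfield L)) L b)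
            (JW_eq (↥(maximalRealSubfield L)) L b)) a χ →ₗ[ℂ]
        ((adelicGroupData (↥(maximalRealSubfield L)) L (IsCMField.complexConj L) 3 H).Adelic → (Fin 2 → ℂ)),
      θ ≠ 0 ∧
        (∀ w, θ w ∈ CotangentForms.cohForms (↥(maximalRealSubfield L)) L (IsCMField.complexConj L) 3 H
            (cmArchSection L ι H T hT) (cmCompactFactor L ι H T hT)) ∧
        ∀ (k : ↥(finAdelic (↥(maximalRealSubfield L)) L (IsCMField.complexConj L) 3 H)) w,
          θ (rhoAtLine (↥(maximalRealSubfield L)) L (IsCMField.complexConj L) 3 e₁ (Matrix.diagonal dV)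
              (complexConj_imagUnit L) (imagUnit_ne_zero L) (imagUnit_mul_self L) (realDiagonal_isSymm L dV hdV)
              (isUnit_det_realDiagonal L dV hdV hdV0) (realDiagonal_map L dV hdV).symm
              (fun a => isCompatible_chiSplittingLine L e₁ dV hdV hdV0 (toHeckeCharacter L μ)
                (isUnitary_toHeckeCharacter L μ) ((isOscillatorChar_toHeckeCharacter_iff μ).mpr hμ)
                (TW (↥(maximalRealSubfield L)) a) (isSymm_TW (↥(maximalRealSubfield L)) a)
                (isUnit_det_TW (↥(maximalRealSubfield L)) a) (JW (↥(maximalRealSubfield L)) L a)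
                (JW_eq (↥(maximalRealSubfield L)) L a)) ιV a χ k w) =
            fun x => θ w (x * finAdelicToAdelic (↥(maximalRealSubfield L)) L (IsCMField.complexConj L) 3 H k) :=
  exists_ne_zero_forall_mem_thetaFunIntertwiner_of_coe L 3 H e₁ dV hdV hdV0 g hg μ hμ a hρ μW _ φ χ ιV hιV
    (fun Φf => Submodule.mem_sup_right
      (thetaPair_mem_map_conjFun_holCotForms_of_arch L ι H T hT e₁ dV hdV hdV0 g hg ιV hιV μ hμ a χ hρ μW φ Φf (hW Φf) (hK Φf) (hH Φf)))
    hN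

end Summit.HodgeConjecture.HodgeConjecture.Cruxes.H413.F0P2sThetaOccursInOfArch

end
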